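import Summits.BirchSwinnertonDyer.BirchSwinnertonDyer.Theorems.GoldfeldAllTwistsTwoConverseTwinQuarterTraceCore
import Mathlib.GroupTheory.OrderOfElement
import HarnessLib

set_option linter.dupNamespace false -- namespace `…BirchSwinnertonDyer.BirchSwinnertonDyer…` is the cell's (D-0017 nested layout)
set_option autoImplicit false

/-!
# LINE B⁗, file X4: the χ_Z CORE — the quarter point is moved by the genus automorphism `σ_p`, hence `y ∉ 4·X₀(49)(K) + tors`
# (FACT-FREE group algebra; the form the χ_Z assembly consumes)

Cell `bsd-goldfeld`, seat `bsd-goldfeld-s1p-c3x` (gen 10); memo `HOME/B4-SIGNATURES.md` §2, file X4 of its §4 plan. `--supports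
stmt-BirchSwinnertonDyer-19140` as a HELPER (twin″, formula axis of `49a1^{(−2qp)}`). Theses-free, Literature-free; theorems only, about an ABSTRACT
abelian group; no `sorry`.

THE STATEMENT. `M` abelian, `σ : M →+ M` (the lift of the genus automorphism `σ_p` of `J/K` acting on points), `T ∈ M` with `2T = 0`, `T ≠ 0`,
`M[4] ⊆ {0, T}`. Data: the quarter point `Z = N•Ψ − N_e•R_e − N_q•Y − N_p•R_p` (`N, N_e, N_p` odd) with `4•Z = N•y + t`, `t ∈ {0,T}`, `σy = y`
(HALVING, `…TwinQuarterTraceHalving` §0), and the `σ_p`-SIGNATURES of memo §2(a): `σY = Y`; `σR_p + R_p` is killed by an odd integer;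
an odd multiple of `σR_e + R_e` is `T`; and the KEY LEMMA of memo §2(L) in its consumable form: an odd multiple of
`N•(σΨ − Ψ) + 2N_e•R_e + 2N_p•R_p` vanishes (the genus-coset difference is its obvious half). CONCLUSIONS:
* `exists_odd_zsmul_map_sub_eq_twoTorsion`: some ODD `n` has `σ(n•Z) − n•Z = T` (the cocycle `χ_Z(σ_p) = T`);
* `not_exists_fixed_four_zsmul`: there are NO `σ`-fixed `S` and odd `N′` with `N′•y = 4•S + t′`, `t′ ∈ {0,T}` — i.e. (`σ`-fixed = `K`-rational)
  **`y ∉ 4·X₀(49)(K) + tors`**, the bit «`y ∈ 2X₀(49)(K)` EXACTLY ONCE» that BSD₂ wants on the two-prime cells (`Tam = 64`).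
HONEST FRAMING: pure group algebra; the signatures and the key lemma are HYPOTHESES here (their derivation from the landed packages and from
(F-η)+(F-D) is the content of files X1–X3 of the plan); no Heegner point is constructed; no case of twin″ is decided; BSD is not proved by any of this.

References: [GrossLMS1991] Prop. 5.3; [CoatesLiTianZhai2015] Thm. 2.5; [SilvermanAEC2009] X.4.9 (the `2`-isogeny descent behind `χ_Z`).
-/

namespace Summit.BirchSwinnertonDyer.BirchSwinnertonDyer.Theorems.GoldfeldGoodTwists

section ChiZCore

variable {M : Type*} [AddCommGroup M]

/-- **The cocycle value `χ_Z(σ_p) = T`.** With `Z = N•Ψ − N_e•R_e − N_q•Y − N_p•R_p` (`N_e` odd), `σY = Y`, `k_p•(σR_p + R_p) = 0`,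
`k_e•(σR_e + R_e) = T` and the key lemma `k•(N•(σΨ − Ψ) + 2N_e•R_e + 2N_p•R_p) = 0` (`k_p, k_e, k` odd): `σ(n•Z) − n•Z = T` for the odd
`n = k·k_e·k_p`. [cite: GrossLMS1991, Prop. 5.3] [cite: CoatesLiTianZhai2015, Thm. 2.5] -/
theorem exists_odd_zsmul_map_sub_eq_twoTorsion (σ : M →+ M) {T : M} (hT2 : 2 • T = 0)
    {Z Ψ Y Re Rp : M} {N Ne Nq Np : ℤ} (hNe : Odd Ne) (hZ : Z = N • Ψ - Ne • Re - Nq • Y - Np • Rp) (hY : σ Y = Y)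
    (hRp : ∃ k : ℤ, Odd k ∧ k • (σ Rp + Rp) = 0) (hRe : ∃ k : ℤ, Odd k ∧ k • (σ Re + Re) = T)
    (hKey : ∃ k : ℤ, Odd k ∧ k • (N • (σ Ψ - Ψ) + (2 * Ne) • Re + (2 * Np) • Rp) = 0) :
    ∃ n : ℤ, Odd n ∧ σ (n • Z) - n • Z = T := by
  obtain ⟨kp, hkp, hkp0⟩ := hRp
  obtain ⟨ke, hke, hkeT⟩ := hRe
  obtain ⟨k, hk, hk0⟩ := hKey
  refine ⟨k * ke * kp, (hk.mul hke).mul hkp, ?_⟩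
  -- `σZ − Z = [N(σΨ − Ψ) + 2N_eR_e + 2N_pR_p] − N_e(σR_e + R_e) − N_p(σR_p + R_p)` (using `σY = Y`)
  have hdiff : σ Z - Z = (N • (σ Ψ - Ψ) + (2 * Ne) • Re + (2 * Np) • Rp) - Ne • (σ Re + Re) - Np • (σ Rp + Rp) := by
    rw [hZ]
    simp only [map_sub, map_zsmul, hY, zsmul_sub, smul_add, mul_zsmul, two_zsmul]
    abel
  rw [map_zsmul, ← zsmul_sub, hdiff, zsmul_sub, zsmul_sub]
  rw [show (k * ke * kp) • (N • (σ Ψ - Ψ) + (2 * Ne) • Re + (2 * Np) • Rp) = 0 by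
        rw [show k * ke * kp = (ke * kp) * k by ring, mul_zsmul, hk0, zsmul_zero],
      show (k * ke * kp) • (Ne • (σ Re + Re)) = T by
        rw [smul_smul, show k * ke * kp * Ne = (k * kp * Ne) * ke by ring, mul_zsmul, hkeT,
          zsmul_twoTorsion_of_odd hT2 ((hk.mul hkp).mul hNe)],
      show (k * ke * kp) • (Np • (σ Rp + Rp)) = 0 by
        rw [smul_smul, show k * ke * kp * Np = (k * ke * Np) * kp by ring, mul_zsmul, hkp0, zsmul_zero]]
  rw [zero_sub, sub_zero]
  exact neg_eq_iff_add_eq_zero.mpr (by rw [← two_nsmul]; exact hT2)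

/-- No element `x` has `4•x = T` when `M[4] ⊆ {0, T}` and `T ≠ 0`, `2T = 0`. [folklore] -/
theorem four_zsmul_ne_twoTorsion {T : M} (hT2 : 2 • T = 0) (hT0 : T ≠ 0) (h4 : ∀ x : M, (4 : ℤ) • x = 0 → x = 0 ∨ x = T)
    (x : M) : (4 : ℤ) • x ≠ T := by
  intro hx
  have hT2z : (2 : ℤ) • T = 0 := by exact_mod_cast hT2
  have h8 : (4 : ℤ) • ((2 : ℤ) • x) = 0 := by rw [smul_comm, hx, hT2z]
  rcases h4 _ h8 with h | h
  · apply hT0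
    rw [← hx, show (4 : ℤ) • x = (2 : ℤ) • ((2 : ℤ) • x) by rw [smul_smul]; norm_num, h, zsmul_zero]
  · apply hT0
    rw [← hx, show (4 : ℤ) • x = (2 : ℤ) • ((2 : ℤ) • x) by rw [smul_smul]; norm_num, h, hT2z]

/-- **`y ∉ 4·M^σ + {0, T}` (up to odd multiples).** If `4•Z = N•y + t` (`N` odd, `t ∈ {0,T}`, `σT = T`), `M[4] ⊆ {0,T}`, and some odd `n`
has `σ(n•Z) − n•Z = T`, then there are no `σ`-fixed `S`, odd `N′` and `t′ ∈ {0, T}` with `N′•y = 4•S + t′`. (Else `4•(N′Z − NS) ∈ {0, T}`,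
so `N′Z − NS ∈ {0, T}` is `σ`-fixed, so `N′•(σZ − Z) = 0`; with `n•(σZ − Z) = T` this gives `N′•T = 0`, i.e. `T = 0`.)
[cite: GrossLMS1991, Prop. 5.3] [cite: SilvermanAEC2009, X.4.9] -/
theorem not_exists_fixed_four_zsmul (σ : M →+ M) {T : M} (hT2 : 2 • T = 0) (hT0 : T ≠ 0) (hσT : σ T = T)
    (h4 : ∀ x : M, (4 : ℤ) • x = 0 → x = 0 ∨ x = T) {Z y t : M} {N : ℤ} (hN : Odd N) (hZ : (4 : ℤ) • Z = N • y + t)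
    (ht : t = 0 ∨ t = T) (hχ : ∃ n : ℤ, Odd n ∧ σ (n • Z) - n • Z = T) :
    ¬ ∃ (S : M) (N' : ℤ) (t' : M), σ S = S ∧ Odd N' ∧ (t' = 0 ∨ t' = T) ∧ N' • y = (4 : ℤ) • S + t' := by
  rintro ⟨S, N', t', hS, hN', ht', hy⟩
  obtain ⟨n, hn, hnZ⟩ := hχ
  -- `4 • (N'Z − NS) = N't + Nt' ∈ {0, T}`
  have h4x : (4 : ℤ) • (N' • Z - N • S) = N' • t + N • t' := by
    have e1 : (4 : ℤ) • (N' • Z) = (N' * N) • y + N' • t := by rw [smul_comm, hZ, zsmul_add, smul_smul]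
    have e2 : (4 : ℤ) • (N • S) = (N * N') • y - N • t' := by
      rw [smul_comm, eq_sub_iff_add_eq, ← zsmul_add, ← hy, smul_smul]
    rw [zsmul_sub, e1, e2, mul_comm N' N]
    abel
  have hmem : N' • t + N • t' = 0 ∨ N' • t + N • t' = T := by
    have h1 : N' • t = 0 ∨ N' • t = T := by
      rcases ht with rfl | rfl
      · exact Or.inl (zsmul_zero _)
      · exact Or.inr (zsmul_twoTorsion_of_odd hT2 hN')
    have h2 : N • t' = 0 ∨ N • t' = T := by
      rcases ht' with rfl | rfl
      · exact Or.inl (zsmul_zero _)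
      · exact Or.inr (zsmul_twoTorsion_of_odd hT2 hN)
    exact add_mem_zero_or_twoTorsion hT2 h1 h2
  have hx : N' • Z - N • S = 0 ∨ N' • Z - N • S = T := by
    rcases hmem with h0 | hT
    · exact h4 _ (by rw [h4x, h0])
    · exact absurd (h4x.trans hT) (four_zsmul_ne_twoTorsion hT2 hT0 h4 _)
  -- `σ` fixes `N'Z − NS`, hence `N' • (σZ − Z) = 0`
  have hfix : σ (N' • Z - N • S) = N' • Z - N • S := by
    rcases hx with h | h
    · rw [h, map_zero]
    · rw [h, hσT]
  have hN'0 : N' • (σ Z - Z) = 0 := by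
    rw [map_sub, map_zsmul, map_zsmul, hS] at hfix
    have := sub_eq_zero.mpr hfix
    rw [show N' • σ Z - N • S - (N' • Z - N • S) = N' • (σ Z - Z) by rw [zsmul_sub]; abel] at this
    exact this
  -- but `n • (σZ − Z) = T`, so `T = N'•(n•(σZ − Z))·… = 0`
  rw [map_zsmul, ← zsmul_sub] at hnZ
  apply hT0
  calc T = N' • T := (zsmul_twoTorsion_of_odd hT2 hN').symm
    _ = n • (N' • (σ Z - Z)) := by rw [← hnZ, smul_smul, smul_smul, mul_comm]
    _ = 0 := by rw [hN'0, zsmul_zero]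

end ChiZCore


end Summit.BirchSwinnertonDyer.BirchSwinnertonDyer.Theorems.GoldfeldGoodTwists
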